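import Literature.IUT.LogVolume.GenuineLogThetaPoint
import Literature.IUT.HodgeTheaters.InitialThetaDataKGaloisProofs
import HarnessLib

/-!
# The Galois bookkeeping of a genuine Θ-volume datum: `F/F_tpd`, `K/F`, `K/F_mod` are Galois

Mochizuki, *Inter-universal Teichmüller theory I*, RIMS manuscript (May 2020), Def. 3.1 (b) ("`F` is Galois over
`F_mod`"), (c) ("`K … the finite Galois extension of `F`"), Rmk. 3.1.5 ("`K` is Galois over `F_mod`"); [IUTchIV] Thm.
1.10 Step (ii) p. 24 (the tower `F_tpd ⊆ F ⊆ K`).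

For a genuine Θ-volume datum `T : Cor22.ThetaVolumeDatumAt P l` (abc-iut-S2 lineage, `GenuineLogThetaPoint.lean`)
the three Galois facts consumed by the (ii′) tower arithmetic of [IUTchIV] Thm. 1.10 Steps (ii)–(iii) (abc-iut-S3's
junction `PointDict.hullVolumeAtDatum_BIII_of_towerFacts`, first three conjuncts) are THEOREMS of the datum:

* `Cor22.ThetaVolumeDatumAt.isGalois_fieldOfModuli_F` — `F/F_mod` Galois (= `T.D.isGalois_fieldOfModuli`, Def. 3.1 (b));
* `Cor22.ThetaVolumeDatumAt.isGalois_fieldOfModuli_K` — `K/F_mod` Galois ([IUTchI] Rmk. 3.1.5, abc-iut-L5 lineage's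
  `InitialThetaData.isGalois_fieldOfModuli_K`, PROVED);
* `Cor22.ThetaVolumeDatumAt.isGalois_F_K` — `K/F` Galois (top of the Galois tower `F_mod ⊆ F ⊆ K`);
* `Cor22.ThetaVolumeDatumAt.isGalois_tpd` — **`F/F_tpd` Galois**: `F_mod = ℚ(j(E_F)) = ℚ(j(λ))` lies in the image of
  `F_tpd = ℚ(λ)` (`T.j_eq`), and `F` is Galois over `F_mod`, hence over the intermediate field `F_tpd`
  (`IsGalois.tower_top_of_isGalois` along an `F_mod`-algebra structure on `F_tpd` built from `T.j_eq`).

PROOF-ONLY (no definitions); classical field theory; TAKES NO SIDE on [IUTchIII] Cor. 3.12.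
-/

noncomputable section

open scoped Classical

namespace Literature.IUT.LogVolume

namespace Cor22

namespace ThetaVolumeDatumAt

open Literature.IUT.HodgeTheaters Literature.NumberTheory.DiophantineGeometry.GenEll IntermediateField

variable {P : NFPoint} {l : ℕ} (T : ThetaVolumeDatumAt P l)

/-- **`F/F_mod` is Galois** for the field of a genuine Θ-volume datum ([IUTchI] Def. 3.1 (b), a field of `T.D`).
[claim: Mochizuki2012, status: disputed] -/
theorem isGalois_fieldOfModuli_F :
    (letI := T.instFieldF; letI := T.instNumberFieldF; letI := T.instIsElliptic; IsGalois (fieldOfModuli T.E) T.F) := by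
  letI := T.instFieldF; letI := T.instNumberFieldF; letI := T.instFieldK; letI := T.instNumberFieldK
  letI := T.instAlgebraK; letI := T.instFieldFbar; letI := T.instAlgebraFbar; letI := T.instAlgebraKFbar
  letI := T.instIsElliptic
  exact T.D.isGalois_fieldOfModuli

/-- **`K/F_mod` is Galois** ([IUTchI] Rmk. 3.1.5: "since the `3`-torsion points of `E_F` are rational over `F`, and `F`
is Galois over `F_mod`, it follows … that `K` is Galois over `F_mod`" — PROVED by the L5 lineage as
`InitialThetaData.isGalois_fieldOfModuli_K`). [claim: Mochizuki2012, status: disputed] -/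
theorem isGalois_fieldOfModuli_K :
    (letI := T.instFieldF; letI := T.instNumberFieldF; letI := T.instFieldK; letI := T.instNumberFieldK
     letI := T.instAlgebraK; letI := T.instIsElliptic; IsGalois (fieldOfModuli T.E) T.K) := by
  letI := T.instFieldF; letI := T.instNumberFieldF; letI := T.instFieldK; letI := T.instNumberFieldK
  letI := T.instAlgebraK; letI := T.instFieldFbar; letI := T.instAlgebraFbar; letI := T.instAlgebraKFbar
  letI := T.instIsElliptic
  exact T.D.isGalois_fieldOfModuli_K

/-- **`K/F` is Galois** ([IUTchI] Def. 3.1 (c): "`K` … the finite Galois extension of `F`"): the top of the Galois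
tower `F_mod ⊆ F ⊆ K`. [claim: Mochizuki2012, status: disputed] -/
theorem isGalois_F_K :
    (letI := T.instFieldF; letI := T.instFieldK; letI := T.instAlgebraK; IsGalois T.F T.K) := by
  letI := T.instFieldF; letI := T.instNumberFieldF; letI := T.instFieldK; letI := T.instNumberFieldK
  letI := T.instAlgebraK; letI := T.instFieldFbar; letI := T.instAlgebraFbar; letI := T.instAlgebraKFbar
  letI := T.instIsElliptic
  haveI := T.D.isScalarTower
  haveI : IsGalois (fieldOfModuli T.E) T.K := T.isGalois_fieldOfModuli_K
  exact IsGalois.tower_top_of_isGalois (fieldOfModuli T.E) T.F T.K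

/-- **`F/F_tpd` is Galois** for the field of every genuine Θ-volume datum at `(P, l)` ([IUTchIV] Thm. 1.10 Step (ii),
p. 24: "`Gal(F/F_tpd)`"): `F_mod = ℚ(j(E_F))` is the image of `ℚ(j(λ)) ⊆ F_tpd` (`T.j_eq`), and `F/F_mod` is Galois.
[claim: Mochizuki2012, status: disputed] -/
theorem isGalois_tpd :
    (letI := T.instFieldF; letI := T.instAlgebraF; IsGalois P.F T.F) := by
  letI := T.instFieldF; letI := T.instNumberFieldF; letI := T.instAlgebraF; letI := T.instFieldK
  letI := T.instNumberFieldK; letI := T.instAlgebraK; letI := T.instFieldFbar; letI := T.instAlgebraFbar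
  letI := T.instAlgebraKFbar; letI := T.instIsElliptic
  haveI : IsGalois (fieldOfModuli T.E) T.F := T.isGalois_fieldOfModuli_F
  -- `F_tpd` as an `F_mod`-algebra: `F_mod = ℚ⟮j(E_F)⟯ ≤ (F_tpd ↪ F).fieldRange` since `j(E_F) = λ-image of j(λ)`
  let f : P.F →ₐ[ℚ] T.F := IsScalarTower.toAlgHom ℚ P.F T.F
  have hle : fieldOfModuli T.E ≤ f.fieldRange := by
    unfold fieldOfModuli
    rw [IntermediateField.adjoin_le_iff]
    rintro _ rfl
    exact ⟨jInv P.x, T.j_eq.symm⟩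
  have hle' : (fieldOfModuli T.E).toSubalgebra ≤ f.range := by
    rw [← AlgHom.fieldRange_toSubalgebra]
    exact hle
  let e : P.F ≃ₐ[ℚ] f.range := AlgEquiv.ofInjectiveField f
  let g : fieldOfModuli T.E →+* P.F :=
    (e.symm : f.range →ₐ[ℚ] P.F).toRingHom.comp (Subalgebra.inclusion hle').toRingHom
  letI : Algebra (fieldOfModuli T.E) P.F := g.toAlgebra
  haveI : IsScalarTower (fieldOfModuli T.E) P.F T.F := by
    refine IsScalarTower.of_algebraMap_eq fun x => ?_
    show (x : T.F) = f (e.symm (Subalgebra.inclusion hle' x))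
    have h1 : (f (e.symm (Subalgebra.inclusion hle' x)) : T.F) =
        ((e (e.symm (Subalgebra.inclusion hle' x)) : f.range) : T.F) := rfl
    rw [h1, AlgEquiv.apply_symm_apply]
    rfl
  exact IsGalois.tower_top_of_isGalois (fieldOfModuli T.E) P.F T.F

end ThetaVolumeDatumAt

end Cor22

end Literature.IUT.LogVolume

end
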